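import Literature.IUT.HodgeTheaters.PiAvatarKitCoreThetaOfBadPairs
import Literature.IUT.HodgeTheaters.PiAvatarKitCoreThetaGluing
import Literature.IUT.HodgeTheaters.InitialThetaDataTorsionCuspModelPointProp67
import Literature.IUT.HodgeTheaters.PiAvatarKitCoreThetaEx44Ex45
import HarnessLib

/-!
# [IUTchI] Rmk 6.12.2 (ii) / Def 6.13 (i)(c), (ii)(c) AT THE GENUINE-SHAPE Θ-NF KIT `baseKitThetaNFOfBadPairs CG hS M hA hI B ΛBad`,
# PARAMETRIC IN THE BAD-PAIR DATA `B`: gluing uniqueness — FACT-LIST F-2049 `GluingUnique`, F-2682 `GluingUniqueBad` instances at the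
# (C″)-OfBadPairs datum `kitCoreThetaOfBadPairs ES` (abc-iut-w5-d129); abc-iut-L5-t3's «KITCORE-THETA-GLUING» (p466266) RE-RUN with the
# `X̲→`-stand-in REPLACED by an arbitrary bad-pair family, plus the JOINT NON-VACUITY of the OfBadPairs binder telescope with the Prop 6.7 body
# at one datum (row «PROP67-EX44-AT-OFBADPAIRS» follow-up «KITCORE-THETA-GLUING-AT-OFBADPAIRS»; proof-only; post-freeze additive, not a cone member)

S. Mochizuki, *Inter-universal Teichmüller theory I*, kurims manuscript (May 2020), Remark 6.12.2 (ii) p. 174 («by Proposition 4.8, (ii); Corollary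
5.6, (ii), the gluing isomorphism that occurs in such a gluing operation is unique»), Definition 6.13 (i)(c) p. 182 («the [necessarily unique!] gluing
isomorphism between `†ℋ𝒯^{Θ±ell}` and `†ℋ𝒯^{ΘNF}`»), (ii)(c) p. 183, Proposition 6.7 p. 167, Definition 3.1 (b)(c) p. 62. ([IUTchI] Rmk 6.12.2 (ii)
p.174) [claim: Mochizuki2012, status: disputed] (D-0012 claim key, series status DISPUTED — kernel theorems over abc-iut-L5-t2's REAL
`InitialThetaData`, abc-iut-L5-t4's genuine-shape Θ-NF kit `baseKitThetaNFOfBadPairs` (`PiAvatarBaseKitThetaNFInstances`), abc-iut-w5-d129's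
(C″)-OfBadPairs datum / core / law (γ) (`PiAvatarKitCoreThetaOfBadPairs`: `baseThetaDatumThetaOfBadPairs`, `kitCoreThetaOfBadPairs`,
`thetaAgrees_thetaOfBadPairs`) and abc-iut-L5-t5's ΘNF-side kit interface `S5Local`; nothing of the series is asserted, no side is taken on
[IUTchIII] Cor. 3.12).

WHAT.  abc-iut-L5-t3's «KITCORE-THETA-GLUING» (`PiAvatarKitCoreThetaGluing`, p466266) instantiates the kit-general gluing-uniqueness theorems
`BaseThetaDatum.KitCore.gluingUnique` / `gluingUniqueBad` / `dGluing_subsingleton` / `gluingUnique_of_surjective` (abc-iut-L5-t3 `PiAvatarKitCoreGluing`,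
label-rigidity route) at the Θ-NF STAND-IN kit `baseKitThetaNFStandIn CG hS M hA hI`, i.e. (definitionally, `PiAvatarBaseKitThetaNFInstances`) at the
genuine-shape kit `baseKitThetaNFOfBadPairs CG hS M hA hI B ΛBad` for the PARTICULAR bad-pair family `B := badPairAtArrow hA` («[`X̲→`-profinite
stand-in at `v̲ ∈ V̲^bad`]»).  THIS FILE runs the same four one-liners at law (γ) `thetaAgrees_thetaOfBadPairs` of the (C″)-OfBadPairs core, so that for
EVERY bad-pair family `B : ∀ v̲ ∈ V̲^bad, BadPairAt v̲` with laws `ΛBad`, EVERY family of evaluation-section binders `ES` at `localDataOfBadPairs`,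
EVERY `F`-kit `FK` and EVERY ΘNF-side kit `N : S5Local (multKitThetaNFOfBadPairs … ES) FK`:
**`gluingUnique_thetaOfBadPairs`** (F-2049), **`gluingUniqueBad_thetaOfBadPairs`** (F-2682), **`dGluing_subsingleton_thetaOfBadPairs`** (Def 6.13
(ii)(c)), **`gluingUnique_thetaOfBadPairs_of_surjective`**, with `Odd l` from Def 3.1 (c) (`odd_l`) and the bad place from Def 3.1 (b)
(`indexCopyBad_nonempty`); and (§2, `rfl`) at `B := badPairAtArrow hA` with the `X̲→`-recipe laws the multiplicative kit IS abc-iut-L5-t4's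
`multKitThetaNFStandIn` (and the `φ^NF` dictionary (C″)'s), so p466266's four stand-in theorems are the SPECIAL CASE of these
(not restated: cite p466266); and (§3, L5-lead RULINGS #110 (4)(b)) the JOINT
NON-VACUITY of the whole telescope {CG, hS, M, hA, hI} ∪ {B, ΛBad} ∪ {ES} AT ONE DATUM together with the Prop 6.7 body (law (γ), Prop 6.7 with
Def 4.6 (ii) as typed in §4, `Nat.card (Hom) = 1`, `Nonempty 𝒟-Θ^±-bridge`) AND gluing uniqueness — `exists_badPairs_evalSections_prop67_gluing_regeom₄` —
and with the Example 4.4 (i)(iii)(iv) / 4.5 (i)(ii) body — `exists_badPairs_evalSections_ex44_ex45_regeom₄` (abc-iut-w4-d077's p488982 shape, by name) —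
at abc-iut-L5-t8's single-point cusp model `regeom₄`, χ-free, by name from abc-iut-w4-d054's `exists_evalSections_prop67_body_regeom₄` (p487623) /
abc-iut-L5-d1's `exists_decompAt_characterFamily_ne_one` (p486714) «[model]» (witness `B := badPairAtArrow`: the stand-in body IS the OfBadPairs body
there, `rfl`).  DISPLAYED BINDERS, exhaustively: {`CG`, `hS`, `M`, `hA`,
`hI`} (kit) ∪ {`B`, `ΛBad`} (bad-pair DATA of OUR `BadPairAt` interface + its `LocalArrowLaw` laws, not constructed here) ∪ {`ES`} ∪ the universally
quantified `FK`, `N`.  HONEST TAG: «instance forms at OUR Θ-NF ambient (`ThetaAmb`: `¬IsIso` by tag; PRICE IN FAITHFULNESS recorded in p462621's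
docstring; D-JΘ1-2)»; what is removed relative to p466266 is the «`X̲→`-stand-in» label only — `𝒟_v̲` at bad `v̲` is `ℬ((B v̲).H)⁰` read in `ThetaAmb`
for an ARBITRARY bad pair, print's tempered `ℬ^temp(X̳_v̲)⁰` being the after-build L2 instance of `B`; a datum over OUR interface witnesses OUR binders
only.  Proof-only; no instance, no notation, no `Prop` fact; typed ≠ inhabited ≠ proved; binder ≠ fact.
-/

noncomputable section

namespace Literature.IUT.HodgeTheaters

open CategoryTheory

universe u v w

section KitCoreThetaOfBadPairsGluing

variable {F : Type u} {K : Type v} {Fbar : Type w} [Field F] [NumberField F] [Field K] [NumberField K]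
  [Algebra F K] [Field Fbar] [Algebra F Fbar] [Algebra K Fbar]
  {E : WeierstrassCurve F} [E.IsElliptic] {l : ℕ} {Pb : BadPlacePredicates K}
  (D : InitialThetaData F K Fbar E l Pb) (CG : D.geom.pe.CuspGalois) (hS : D.CuspClassesNormaliserStable) [Fact l.Prime]
  (M : D.TorsionMonodromy) (hA : D.geom.pe.ArrowCoveringClaims)
  (hI : ∀ k ∈ D.geom.pe.inertia D.geom.pe.ε1, M.tau (D.geom.embK k) = 0)
  (B : ∀ v, v ∈ D.indexCopyBad → D.BadPairAt v) (ΛBad : ∀ v (h : v ∈ D.indexCopyBad), D.LocalArrowLaw CG hS (B v h).H)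

namespace InitialThetaData

/-! ### §1. Gluing uniqueness at the (C″)-OfBadPairs core (F-2049 / F-2682 / Def 6.13 (ii)(c) instances, parametric in `B`) -/

variable {Gv : D.IndexCopy → Subgroup (Fbar ≃ₐ[F] Fbar)}
  (ES : ∀ v, v ∈ D.indexCopyBad → EvalSectionBinder (D.localDataOfBadPairs CG hS M hA hI B ΛBad v) (Gv v))

/-- **F-2049 `GluingUnique` AT THE GENUINE-SHAPE Θ-NF KIT, parametric in the bad-pair data `B`** ([IUTchI] Rmk 6.12.2 (ii) / Def 6.13 (i)(c):
the gluing of `†ℋ𝒯^{Θ±ell}` and `†ℋ𝒯^{ΘNF}` along their `𝒟`-prime-strips is unique): for EVERY `F`-kit `FK` and EVERY ΘNF-side kit `N` over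
`baseKitThetaNFOfBadPairs CG hS M hA hI B ΛBad` and the multiplicative kit generated by the evaluation sections `ES` — abc-iut-L5-t3's
`KitCore.gluingUnique` at abc-iut-w5-d129's core `kitCoreThetaOfBadPairs ES` / law (γ) `thetaAgrees_thetaOfBadPairs`; the bad place needed is
Def 3.1 (b) (`indexCopyBad_nonempty`), `Odd l` is Def 3.1 (c) (`odd_l`).  DISPLAYED: {CG, hS, M, hA, hI} ∪ {B, ΛBad} ∪ {ES}.
([IUTchI] Rmk 6.12.2 (ii) p.174) [claim: Mochizuki2012, status: disputed] -/
theorem gluingUnique_thetaOfBadPairs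
    {FK : (D.baseKitThetaNFOfBadPairs CG hS M hA hI B ΛBad).FKit (D.multKitThetaNFOfBadPairs CG hS M hA hI B ΛBad ES)}
    (N : (D.baseKitThetaNFOfBadPairs CG hS M hA hI B ΛBad).S5Local (D.multKitThetaNFOfBadPairs CG hS M hA hI B ΛBad ES) FK) :
    N.GluingUnique D.odd_l := by
  obtain ⟨x, hx⟩ := D.indexCopyBad_nonempty
  exact BaseThetaDatum.KitCore.gluingUnique (D.thetaAgrees_thetaOfBadPairs CG hS M hA hI B ΛBad ES) D.odd_l N hx

/-- **F-2682 `GluingUniqueBad` AT THE GENUINE-SHAPE Θ-NF KIT, parametric in `B`** (abc-iut-L5-t5's guarded form `𝕍^bad ≠ ∅ → GluingUnique`).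
([IUTchI] Rmk 6.12.2 (ii) p.174) [claim: Mochizuki2012, status: disputed] -/
theorem gluingUniqueBad_thetaOfBadPairs
    {FK : (D.baseKitThetaNFOfBadPairs CG hS M hA hI B ΛBad).FKit (D.multKitThetaNFOfBadPairs CG hS M hA hI B ΛBad ES)}
    (N : (D.baseKitThetaNFOfBadPairs CG hS M hA hI B ΛBad).S5Local (D.multKitThetaNFOfBadPairs CG hS M hA hI B ΛBad ES) FK) :
    N.GluingUniqueBad D.odd_l :=
  BaseThetaDatum.KitCore.gluingUniqueBad (D.thetaAgrees_thetaOfBadPairs CG hS M hA hI B ΛBad ES) D.odd_l N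

/-- **[IUTchI] Def 6.13 (ii)(c) AT THE GENUINE-SHAPE Θ-NF KIT, parametric in `B`**: the `𝒟`-level gluing of a `𝒟-ΘNF`-Hodge theater to a
`𝒟-Θ^±`-bridge via the functor of Proposition 6.7 is unique (`Subsingleton`). ([IUTchI] Def 6.13 (ii) p.183) [claim: Mochizuki2012, status: disputed] -/
theorem dGluing_subsingleton_thetaOfBadPairs
    {FK : (D.baseKitThetaNFOfBadPairs CG hS M hA hI B ΛBad).FKit (D.multKitThetaNFOfBadPairs CG hS M hA hI B ΛBad ES)}
    (N : (D.baseKitThetaNFOfBadPairs CG hS M hA hI B ΛBad).S5Local (D.multKitThetaNFOfBadPairs CG hS M hA hI B ΛBad ES) FK)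
    (Bpm : (D.baseKitThetaNFOfBadPairs CG hS M hA hI B ΛBad).DThetaPMBridge) (X : N.DNFHT) :
    Subsingleton (N.DThetaGluing Bpm X D.odd_l) := by
  obtain ⟨x, hx⟩ := D.indexCopyBad_nonempty
  exact BaseThetaDatum.KitCore.dGluing_subsingleton (D.thetaAgrees_thetaOfBadPairs CG hS M hA hI B ΛBad ES) D.odd_l N hx Bpm X

/-- **Rmk 6.12.2 (ii), comparison of index sets onto, parametric in `B`**: `GluingUnique` also holds outright through the SURJECTIVITY of the core's
index comparison (`kitCoreThetaOfBadPairs_e`: the identity). ([IUTchI] Rmk 6.12.2 (ii) p.174) [claim: Mochizuki2012, status: disputed] -/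
theorem gluingUnique_thetaOfBadPairs_of_surjective
    {FK : (D.baseKitThetaNFOfBadPairs CG hS M hA hI B ΛBad).FKit (D.multKitThetaNFOfBadPairs CG hS M hA hI B ΛBad ES)}
    (N : (D.baseKitThetaNFOfBadPairs CG hS M hA hI B ΛBad).S5Local (D.multKitThetaNFOfBadPairs CG hS M hA hI B ΛBad ES) FK) :
    N.GluingUnique D.odd_l :=
  BaseThetaDatum.KitCore.gluingUnique_of_surjective (D.thetaAgrees_thetaOfBadPairs CG hS M hA hI B ΛBad ES) (fun x => ⟨x, rfl⟩) D.odd_l N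

/-- **Existential packaging for certificates** (shape of (C″)'s `exists_kitCore_thetaAgrees_…`, extended by the gluing conclusion): over the
genuine-shape Θ-NF kit there EXIST a core agreement with the (C″)-OfBadPairs §4 datum and a multiplicative kit with law (γ) such that, for every
`F`-kit and every ΘNF-side kit over that multiplicative kit, the gluing is unique. ([IUTchI] Rmk 6.12.2 (ii) p.174) [claim: Mochizuki2012, status: disputed] -/
theorem exists_kitCore_thetaAgrees_gluingUnique_thetaOfBadPairs :
    ∃ (c : (D.baseThetaDatumThetaOfBadPairs CG hS M hA hI B ΛBad ES).KitCore (D.baseKitThetaNFOfBadPairs CG hS M hA hI B ΛBad))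
      (Mk : (D.baseKitThetaNFOfBadPairs CG hS M hA hI B ΛBad).MultKit), c.ThetaAgrees Mk ∧
      ∀ (FK : (D.baseKitThetaNFOfBadPairs CG hS M hA hI B ΛBad).FKit Mk)
        (N : (D.baseKitThetaNFOfBadPairs CG hS M hA hI B ΛBad).S5Local Mk FK), N.GluingUnique D.odd_l :=
  ⟨D.kitCoreThetaOfBadPairs CG hS M hA hI B ΛBad ES, D.multKitThetaNFOfBadPairs CG hS M hA hI B ΛBad ES,
    D.thetaAgrees_thetaOfBadPairs CG hS M hA hI B ΛBad ES, fun _ N => D.gluingUnique_thetaOfBadPairs CG hS M hA hI B ΛBad ES N⟩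

end InitialThetaData

/-! ### §2. COMPARISON (`rfl`): at `B := badPairAtArrow`, the `X̲→`-recipe laws, p466266's stand-in gluing theorems are the special case -/

namespace InitialThetaData

variable {Gv : D.IndexCopy → Subgroup (Fbar ≃ₐ[F] Fbar)}
  (ES : ∀ v, v ∈ D.indexCopyBad → EvalSectionBinder (D.localDataStandIn CG hS M hA hI v) (Gv v))

/-- **abc-iut-L5-t4's stand-in multiplicative kit IS the OfBadPairs one at `B := badPairAtArrow hA` with the `X̲→`-recipe laws** (definitional,
`multKitThetaNFStandIn := multKitThetaNFOfBadPairs _ _`), so the `S5Local`'s of p466266's theorems are `S5Local`'s of §1's.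
([IUTchI] Prop 6.7 p.167) [claim: Mochizuki2012, status: disputed] -/
theorem multKitThetaNFOfBadPairs_standIn :
    D.multKitThetaNFOfBadPairs CG hS M hA hI (fun v _ => D.badPairAtArrow hA v)
        (fun v _ => D.localArrowLaw_local_of_torsionMonodromy CG hS M hA hI (D.decompAt v)) ES =
      D.multKitThetaNFStandIn CG hS M hA hI ES := rfl

/-- **(C″)'s stand-in `φ^NF` dictionary IS the OfBadPairs one at `B := badPairAtArrow hA`** (definitional; complements abc-iut-w5-d129's
`baseThetaDatumThetaStandIn_eq_ofBadPairs` / `kitCoreThetaStandIn_eq_ofBadPairs`). ([IUTchI] Ex 4.3 (ii) p.99) [claim: Mochizuki2012, status: disputed] -/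
theorem nfLinkThetaOfBadPairs_standIn :
    D.nfLinkThetaOfBadPairs CG hS M hA hI (fun v _ => D.badPairAtArrow hA v)
        (fun v _ => D.localArrowLaw_local_of_torsionMonodromy CG hS M hA hI (D.decompAt v)) ES =
      D.nfLinkThetaStandIn CG hS M hA hI ES := rfl

end InitialThetaData

end KitCoreThetaOfBadPairsGluing

/-! ### §3. JOINT NON-VACUITY of the whole binder telescope {CG, hS, M, hA, hI} ∪ {B, ΛBad} ∪ {ES} AT ONE DATUM, with the Prop 6.7 body
AND gluing uniqueness holding there (L5-lead #110 (4)(b); by name from abc-iut-w4-d054 p487623 / abc-iut-L5-d1 p486714, χ-free) «[model]» -/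

section KitCoreThetaOfBadPairsNV

namespace InitialThetaData

variable {F K Fbar : Type u} [Field F] [NumberField F] [Field K] [NumberField K] [Algebra F K] [Field Fbar]
  [Algebra F Fbar] [Algebra K Fbar] {E : WeierstrassCurve F} [E.IsElliptic] {l : ℕ} {Pb : BadPlacePredicates K}
  (D₀ : InitialThetaData F K Fbar E l Pb) [Fact l.Prime]

/-- **JOINT NON-VACUITY AT ONE DATUM of the OfBadPairs binder telescope, WITH the Prop 6.7 body and gluing uniqueness** «[model]»: at
abc-iut-L5-t8's single-point cusp model `D₀.regeom₄` (kit binders the stage-C named terms `cuspGaloisRegeom₄` / `cuspClassesNormaliserStable_regeom₄` /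
`unramifiedTorsionMonodromyRegeom₄` / `arrowCoveringClaimsRegeom₄` / `tau_inertia`) there EXIST a bad-pair family `B`, laws `ΛBad` and
evaluation-section binders `ES` at `localDataOfBadPairs … B ΛBad` such that — at abc-iut-w5-d129's (C″)-OfBadPairs core `kitCoreThetaOfBadPairs … B ΛBad ES` —
law (γ) holds, [IUTchI] Prop 6.7 holds with Def 4.6 (ii) AS TYPED IN §4, «well-defined up to a UNIQUE isomorphism» (`Nat.card (Hom) = 1`), the
`∀ 𝒟-Θ^±-bridge` quantifier is inhabited, AND for every `F`-kit / ΘNF-side kit the gluing is unique (F-2049).  WITNESS: `B := badPairAtArrow`, `ΛBad :=`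
the `X̲→`-recipe laws (theorems), `ES :=` abc-iut-w4-d054's `exists_evalSections_prop67_body_regeom₄` (p487623; characters from abc-iut-L5-d1's
`exists_decompAt_characterFamily_ne_one`, p486714) — the stand-in body IS the OfBadPairs body there by `rfl`.  A model witnesses OUR binders only.
([IUTchI] Prop 6.7 p.167) [claim: Mochizuki2012, status: disputed] -/
theorem exists_badPairs_evalSections_prop67_gluing_regeom₄ :
    ∃ (B : ∀ v, v ∈ D₀.regeom₄.indexCopyBad → D₀.regeom₄.BadPairAt v)
      (ΛBad : ∀ v (h : v ∈ D₀.regeom₄.indexCopyBad),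
        D₀.regeom₄.LocalArrowLaw D₀.cuspGaloisRegeom₄ D₀.cuspClassesNormaliserStable_regeom₄ (B v h).H)
      (ES : ∀ v (_ : v ∈ D₀.regeom₄.indexCopyBad),
        EvalSectionBinder
          (D₀.regeom₄.localDataOfBadPairs D₀.cuspGaloisRegeom₄ D₀.cuspClassesNormaliserStable_regeom₄
            D₀.unramifiedTorsionMonodromyRegeom₄.toTorsionMonodromy D₀.arrowCoveringClaimsRegeom₄
            (D₀.unramifiedTorsionMonodromyRegeom₄.tau_inertia _) B ΛBad v)
          (D₀.regeom₄.decompAt v)),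
      (D₀.regeom₄.kitCoreThetaOfBadPairs D₀.cuspGaloisRegeom₄ D₀.cuspClassesNormaliserStable_regeom₄
          D₀.unramifiedTorsionMonodromyRegeom₄.toTorsionMonodromy D₀.arrowCoveringClaimsRegeom₄
          (D₀.unramifiedTorsionMonodromyRegeom₄.tau_inertia _) B ΛBad ES).ThetaAgrees
        (D₀.regeom₄.multKitThetaNFOfBadPairs D₀.cuspGaloisRegeom₄ D₀.cuspClassesNormaliserStable_regeom₄
          D₀.unramifiedTorsionMonodromyRegeom₄.toTorsionMonodromy D₀.arrowCoveringClaimsRegeom₄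
          (D₀.unramifiedTorsionMonodromyRegeom₄.tau_inertia _) B ΛBad ES) ∧
      PMBaseKit.DThetaPMBridge.ThetaBridgeAlgorithm
        (D₀.regeom₄.multKitThetaNFOfBadPairs D₀.cuspGaloisRegeom₄ D₀.cuspClassesNormaliserStable_regeom₄
          D₀.unramifiedTorsionMonodromyRegeom₄.toTorsionMonodromy D₀.arrowCoveringClaimsRegeom₄
          (D₀.unramifiedTorsionMonodromyRegeom₄.tau_inertia _) B ΛBad ES)
        (fun Dt => ∃ (B' : (D₀.regeom₄.baseThetaDatumThetaOfBadPairs D₀.cuspGaloisRegeom₄ D₀.cuspClassesNormaliserStable_regeom₄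
              D₀.unramifiedTorsionMonodromyRegeom₄.toTorsionMonodromy D₀.arrowCoveringClaimsRegeom₄
              (D₀.unramifiedTorsionMonodromyRegeom₄.tau_inertia _) B ΛBad ES).DThetaBridge) (ι : Dt.J ≃ B'.J)
            (κ : ∀ j x, (B'.capsule (ι j) x).obj ≅ (Dt.capsule j).obj x)
            (γ : ∀ x, (B'.cod x).obj ≅ Dt.codomain.obj x),
            ∀ j x, Dt.poly j x = {g | ∃ f ∈ B'.poly (ι j) x, g = (κ j x).inv ≫ f.hom ≫ (γ x).hom})
        D₀.regeom₄.odd_l ∧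
      (∀ B₁ B₂ : (D₀.regeom₄.baseKitThetaNFOfBadPairs D₀.cuspGaloisRegeom₄ D₀.cuspClassesNormaliserStable_regeom₄
          D₀.unramifiedTorsionMonodromyRegeom₄.toTorsionMonodromy D₀.arrowCoveringClaimsRegeom₄
          (D₀.unramifiedTorsionMonodromyRegeom₄.tau_inertia _) B ΛBad).DThetaPMBridge,
        Nat.card (PMBaseKit.DThetaBridgeData.Hom
          (B₁.thetaBridgeData (D₀.regeom₄.multKitThetaNFOfBadPairs D₀.cuspGaloisRegeom₄ D₀.cuspClassesNormaliserStable_regeom₄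
            D₀.unramifiedTorsionMonodromyRegeom₄.toTorsionMonodromy D₀.arrowCoveringClaimsRegeom₄
            (D₀.unramifiedTorsionMonodromyRegeom₄.tau_inertia _) B ΛBad ES) D₀.regeom₄.odd_l)
          (B₂.thetaBridgeData (D₀.regeom₄.multKitThetaNFOfBadPairs D₀.cuspGaloisRegeom₄ D₀.cuspClassesNormaliserStable_regeom₄
            D₀.unramifiedTorsionMonodromyRegeom₄.toTorsionMonodromy D₀.arrowCoveringClaimsRegeom₄
            (D₀.unramifiedTorsionMonodromyRegeom₄.tau_inertia _) B ΛBad ES) D₀.regeom₄.odd_l)) = 1) ∧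
      Nonempty (D₀.regeom₄.baseKitThetaNFOfBadPairs D₀.cuspGaloisRegeom₄ D₀.cuspClassesNormaliserStable_regeom₄
          D₀.unramifiedTorsionMonodromyRegeom₄.toTorsionMonodromy D₀.arrowCoveringClaimsRegeom₄
          (D₀.unramifiedTorsionMonodromyRegeom₄.tau_inertia _) B ΛBad).DThetaPMBridge ∧
      (∀ (FK : (D₀.regeom₄.baseKitThetaNFOfBadPairs D₀.cuspGaloisRegeom₄ D₀.cuspClassesNormaliserStable_regeom₄
            D₀.unramifiedTorsionMonodromyRegeom₄.toTorsionMonodromy D₀.arrowCoveringClaimsRegeom₄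
            (D₀.unramifiedTorsionMonodromyRegeom₄.tau_inertia _) B ΛBad).FKit
            (D₀.regeom₄.multKitThetaNFOfBadPairs D₀.cuspGaloisRegeom₄ D₀.cuspClassesNormaliserStable_regeom₄
              D₀.unramifiedTorsionMonodromyRegeom₄.toTorsionMonodromy D₀.arrowCoveringClaimsRegeom₄
              (D₀.unramifiedTorsionMonodromyRegeom₄.tau_inertia _) B ΛBad ES))
          (N : (D₀.regeom₄.baseKitThetaNFOfBadPairs D₀.cuspGaloisRegeom₄ D₀.cuspClassesNormaliserStable_regeom₄
            D₀.unramifiedTorsionMonodromyRegeom₄.toTorsionMonodromy D₀.arrowCoveringClaimsRegeom₄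
            (D₀.unramifiedTorsionMonodromyRegeom₄.tau_inertia _) B ΛBad).S5Local
            (D₀.regeom₄.multKitThetaNFOfBadPairs D₀.cuspGaloisRegeom₄ D₀.cuspClassesNormaliserStable_regeom₄
              D₀.unramifiedTorsionMonodromyRegeom₄.toTorsionMonodromy D₀.arrowCoveringClaimsRegeom₄
              (D₀.unramifiedTorsionMonodromyRegeom₄.tau_inertia _) B ΛBad ES) FK),
        N.GluingUnique D₀.regeom₄.odd_l) := by
  obtain ⟨ES, hγ, h67, hcard, hne⟩ := D₀.exists_evalSections_prop67_body_regeom₄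
  exact ⟨fun v _ => D₀.regeom₄.badPairAtArrow D₀.arrowCoveringClaimsRegeom₄ v,
    fun v _ => D₀.regeom₄.localArrowLaw_local_of_torsionMonodromy D₀.cuspGaloisRegeom₄ D₀.cuspClassesNormaliserStable_regeom₄
      D₀.unramifiedTorsionMonodromyRegeom₄.toTorsionMonodromy D₀.arrowCoveringClaimsRegeom₄
      (D₀.unramifiedTorsionMonodromyRegeom₄.tau_inertia _) (D₀.regeom₄.decompAt v),
    ES, hγ, h67, hcard, hne, fun _ N => D₀.regeom₄.gluingUnique_thetaOfBadPairs _ _ _ _ _ _ _ ES N⟩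

open Classical in
/-- **JOINT NON-VACUITY AT ONE DATUM of the OfBadPairs binder telescope, WITH the Example 4.4 (i)(iii)(iv) / Example 4.5 (i)(ii) body** «[model]»
(the shape of abc-iut-w4-d077's `exists_kitCore_ex44_ex45_thetaStandIn`, p488982, at abc-iut-L5-t8's `regeom₄`): there EXIST `B`, `ΛBad`, `ES` at
`localDataOfBadPairs … B ΛBad` and a core agreement of the genuine-shape kit with abc-iut-w5-d129's (C″)-OfBadPairs §4 datum, identity on places, such
that — Ex 4.4 (i) — at every bad `v̲` every label `j ∈ |𝔽_l|` is carried by a morphism `𝒟_v̲ → 𝒟_v̲` of the class GENERATED BY THE SECTION `s_j` of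
`ES v̲` which IS an evaluation section of label `j` of the datum; — Ex 4.4 (iv) — labels of constituents of `φ^Θ_{v̲_j}` are well defined; — Ex 4.4
(iii) — at good `v̲` `φ^Θ_{v̲_j}` is the full poly-isomorphism; — Ex 4.5 (i)/(ii) — `g · [ε] ↦ g · η_v̲` along `φ^NF_{•,v̲}`.  WITNESS: `B := badPairAtArrow`,
the `X̲→`-recipe laws, the χ-free sections of abc-iut-L5-d1 (p486714) through abc-iut-w4-d054's p487623, and p488982's theorem BY NAME (the stand-in
body IS the OfBadPairs body there, `rfl`).  A model witnesses OUR binders only. ([IUTchI] Ex 4.4 (i) p.106) [claim: Mochizuki2012, status: disputed] -/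
theorem exists_badPairs_evalSections_ex44_ex45_regeom₄ :
    ∃ (B : ∀ v, v ∈ D₀.regeom₄.indexCopyBad → D₀.regeom₄.BadPairAt v)
      (ΛBad : ∀ v (h : v ∈ D₀.regeom₄.indexCopyBad),
        D₀.regeom₄.LocalArrowLaw D₀.cuspGaloisRegeom₄ D₀.cuspClassesNormaliserStable_regeom₄ (B v h).H)
      (ES : ∀ v (_ : v ∈ D₀.regeom₄.indexCopyBad),
        EvalSectionBinder
          (D₀.regeom₄.localDataOfBadPairs D₀.cuspGaloisRegeom₄ D₀.cuspClassesNormaliserStable_regeom₄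
            D₀.unramifiedTorsionMonodromyRegeom₄.toTorsionMonodromy D₀.arrowCoveringClaimsRegeom₄
            (D₀.unramifiedTorsionMonodromyRegeom₄.tau_inertia _) B ΛBad v)
          (D₀.regeom₄.decompAt v))
      (c : (D₀.regeom₄.baseThetaDatumThetaOfBadPairs D₀.cuspGaloisRegeom₄ D₀.cuspClassesNormaliserStable_regeom₄
            D₀.unramifiedTorsionMonodromyRegeom₄.toTorsionMonodromy D₀.arrowCoveringClaimsRegeom₄
            (D₀.unramifiedTorsionMonodromyRegeom₄.tau_inertia _) B ΛBad ES).KitCore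
        (D₀.regeom₄.baseKitThetaNFOfBadPairs D₀.cuspGaloisRegeom₄ D₀.cuspClassesNormaliserStable_regeom₄
            D₀.unramifiedTorsionMonodromyRegeom₄.toTorsionMonodromy D₀.arrowCoveringClaimsRegeom₄
            (D₀.unramifiedTorsionMonodromyRegeom₄.tau_inertia _) B ΛBad)),
      (∀ x, c.e x = x) ∧
      (∀ (v : D₀.regeom₄.IndexCopy) (hv : v ∈ D₀.regeom₄.indexCopyBad) (j : FlAbs l),
        ∃ g : (D₀.regeom₄.baseKitThetaNFOfBadPairs D₀.cuspGaloisRegeom₄ D₀.cuspClassesNormaliserStable_regeom₄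
            D₀.unramifiedTorsionMonodromyRegeom₄.toTorsionMonodromy D₀.arrowCoveringClaimsRegeom₄
            (D₀.unramifiedTorsionMonodromyRegeom₄.tau_inertia _) B ΛBad).model v ⟶
            (D₀.regeom₄.baseKitThetaNFOfBadPairs D₀.cuspGaloisRegeom₄ D₀.cuspClassesNormaliserStable_regeom₄
            D₀.unramifiedTorsionMonodromyRegeom₄.toTorsionMonodromy D₀.arrowCoveringClaimsRegeom₄
            (D₀.unramifiedTorsionMonodromyRegeom₄.tau_inertia _) B ΛBad).model v,
          (haveI := D₀.unramifiedTorsionMonodromyRegeom₄.toTorsionMonodromy.normal_PiXund_subgroupOf_PiXK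
           g ∈ D₀.regeom₄.thetaFamilyNF
             (D₀.regeom₄.toFlStarGlobal_surjective_of_torsionMonodromy D₀.unramifiedTorsionMonodromyRegeom₄.toTorsionMonodromy)
             D₀.regeom₄.indexCopyBad D₀.regeom₄.indexCopyArc
             (D₀.regeom₄.localDataOfBadPairs D₀.cuspGaloisRegeom₄ D₀.cuspClassesNormaliserStable_regeom₄
            D₀.unramifiedTorsionMonodromyRegeom₄.toTorsionMonodromy D₀.arrowCoveringClaimsRegeom₄
            (D₀.unramifiedTorsionMonodromyRegeom₄.tau_inertia _) B ΛBad) ES v hv j) ∧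
          (D₀.regeom₄.baseThetaDatumThetaOfBadPairs D₀.cuspGaloisRegeom₄ D₀.cuspClassesNormaliserStable_regeom₄
            D₀.unramifiedTorsionMonodromyRegeom₄.toTorsionMonodromy D₀.arrowCoveringClaimsRegeom₄
            (D₀.unramifiedTorsionMonodromyRegeom₄.tau_inertia _) B ΛBad ES).IsEvalSection (v := v)
            (X := (D₀.regeom₄.baseKitThetaNFOfBadPairs D₀.cuspGaloisRegeom₄ D₀.cuspClassesNormaliserStable_regeom₄
            D₀.unramifiedTorsionMonodromyRegeom₄.toTorsionMonodromy D₀.arrowCoveringClaimsRegeom₄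
            (D₀.unramifiedTorsionMonodromyRegeom₄.tau_inertia _) B ΛBad).localModel v)
            (Y := (D₀.regeom₄.baseKitThetaNFOfBadPairs D₀.cuspGaloisRegeom₄ D₀.cuspClassesNormaliserStable_regeom₄
            D₀.unramifiedTorsionMonodromyRegeom₄.toTorsionMonodromy D₀.arrowCoveringClaimsRegeom₄
            (D₀.unramifiedTorsionMonodromyRegeom₄.tau_inertia _) B ΛBad).localModel v)
            hv j (ObjectProperty.homMk g)) ∧
      (∀ (v : D₀.regeom₄.IndexCopy) (_ : v ∈ D₀.regeom₄.indexCopyBad) (j j' : FlStar l)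
        (X Y : (D₀.regeom₄.baseKitThetaNFOfBadPairs D₀.cuspGaloisRegeom₄ D₀.cuspClassesNormaliserStable_regeom₄
            D₀.unramifiedTorsionMonodromyRegeom₄.toTorsionMonodromy D₀.arrowCoveringClaimsRegeom₄
            (D₀.unramifiedTorsionMonodromyRegeom₄.tau_inertia _) B ΛBad).LocalObj v)
        (f : X ⟶ Y), f ∈ (D₀.regeom₄.baseThetaDatumThetaOfBadPairs D₀.cuspGaloisRegeom₄ D₀.cuspClassesNormaliserStable_regeom₄
            D₀.unramifiedTorsionMonodromyRegeom₄.toTorsionMonodromy D₀.arrowCoveringClaimsRegeom₄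
            (D₀.unramifiedTorsionMonodromyRegeom₄.tau_inertia _) B ΛBad ES).phiThetaAt j v X Y →
          f ∈ (D₀.regeom₄.baseThetaDatumThetaOfBadPairs D₀.cuspGaloisRegeom₄ D₀.cuspClassesNormaliserStable_regeom₄
            D₀.unramifiedTorsionMonodromyRegeom₄.toTorsionMonodromy D₀.arrowCoveringClaimsRegeom₄
            (D₀.unramifiedTorsionMonodromyRegeom₄.tau_inertia _) B ΛBad ES).phiThetaAt j' v X Y → j = j') ∧
      (∀ (v : D₀.regeom₄.IndexCopy), v ∉ D₀.regeom₄.indexCopyBad → ∀ (j : FlStar l)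
        (X Y : (D₀.regeom₄.baseKitThetaNFOfBadPairs D₀.cuspGaloisRegeom₄ D₀.cuspClassesNormaliserStable_regeom₄
            D₀.unramifiedTorsionMonodromyRegeom₄.toTorsionMonodromy D₀.arrowCoveringClaimsRegeom₄
            (D₀.unramifiedTorsionMonodromyRegeom₄.tau_inertia _) B ΛBad).LocalObj v),
        (D₀.regeom₄.baseThetaDatumThetaOfBadPairs D₀.cuspGaloisRegeom₄ D₀.cuspClassesNormaliserStable_regeom₄
            D₀.unramifiedTorsionMonodromyRegeom₄.toTorsionMonodromy D₀.arrowCoveringClaimsRegeom₄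
            (D₀.unramifiedTorsionMonodromyRegeom₄.tau_inertia _) B ΛBad ES).phiThetaAt j v X Y = PolyHom.full X Y) ∧
      (∀ (v : D₀.regeom₄.IndexCopy) (g : FlStar (D₀.regeom₄.baseThetaDatumThetaOfBadPairs D₀.cuspGaloisRegeom₄ D₀.cuspClassesNormaliserStable_regeom₄
            D₀.unramifiedTorsionMonodromyRegeom₄.toTorsionMonodromy D₀.arrowCoveringClaimsRegeom₄
            (D₀.unramifiedTorsionMonodromyRegeom₄.tau_inertia _) B ΛBad ES).l),
        (D₀.regeom₄.baseThetaDatumThetaOfBadPairs D₀.cuspGaloisRegeom₄ D₀.cuspClassesNormaliserStable_regeom₄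
            D₀.unramifiedTorsionMonodromyRegeom₄.toTorsionMonodromy D₀.arrowCoveringClaimsRegeom₄
            (D₀.unramifiedTorsionMonodromyRegeom₄.tau_inertia _) B ΛBad ES).labPull
            ((D₀.regeom₄.baseThetaDatumThetaOfBadPairs D₀.cuspGaloisRegeom₄ D₀.cuspClassesNormaliserStable_regeom₄
            D₀.unramifiedTorsionMonodromyRegeom₄.toTorsionMonodromy D₀.arrowCoveringClaimsRegeom₄
            (D₀.unramifiedTorsionMonodromyRegeom₄.tau_inertia _) B ΛBad ES).phiNF v)
            (g • (D₀.regeom₄.baseThetaDatumThetaOfBadPairs D₀.cuspGaloisRegeom₄ D₀.cuspClassesNormaliserStable_regeom₄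
            D₀.unramifiedTorsionMonodromyRegeom₄.toTorsionMonodromy D₀.arrowCoveringClaimsRegeom₄
            (D₀.unramifiedTorsionMonodromyRegeom₄.tau_inertia _) B ΛBad ES).εLab) =
          g • (D₀.regeom₄.baseThetaDatumThetaOfBadPairs D₀.cuspGaloisRegeom₄ D₀.cuspClassesNormaliserStable_regeom₄
            D₀.unramifiedTorsionMonodromyRegeom₄.toTorsionMonodromy D₀.arrowCoveringClaimsRegeom₄
            (D₀.unramifiedTorsionMonodromyRegeom₄.tau_inertia _) B ΛBad ES).η v
            ((D₀.regeom₄.baseThetaDatumThetaOfBadPairs D₀.cuspGaloisRegeom₄ D₀.cuspClassesNormaliserStable_regeom₄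
            D₀.unramifiedTorsionMonodromyRegeom₄.toTorsionMonodromy D₀.arrowCoveringClaimsRegeom₄
            (D₀.unramifiedTorsionMonodromyRegeom₄.tau_inertia _) B ΛBad ES).D v)) := by
  obtain ⟨ES, -⟩ := D₀.exists_evalSections_prop67_body_regeom₄
  obtain ⟨c, hc⟩ := D₀.regeom₄.exists_kitCore_ex44_ex45_thetaStandIn D₀.cuspGaloisRegeom₄ D₀.cuspClassesNormaliserStable_regeom₄
    D₀.unramifiedTorsionMonodromyRegeom₄.toTorsionMonodromy D₀.arrowCoveringClaimsRegeom₄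
    (D₀.unramifiedTorsionMonodromyRegeom₄.tau_inertia _) ES
  exact ⟨fun v _ => D₀.regeom₄.badPairAtArrow D₀.arrowCoveringClaimsRegeom₄ v,
    fun v _ => D₀.regeom₄.localArrowLaw_local_of_torsionMonodromy D₀.cuspGaloisRegeom₄ D₀.cuspClassesNormaliserStable_regeom₄
      D₀.unramifiedTorsionMonodromyRegeom₄.toTorsionMonodromy D₀.arrowCoveringClaimsRegeom₄
      (D₀.unramifiedTorsionMonodromyRegeom₄.tau_inertia _) (D₀.regeom₄.decompAt v),
    ES, c, hc⟩

end InitialThetaData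

end KitCoreThetaOfBadPairsNV

end Literature.IUT.HodgeTheaters
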